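import Literature.Analysis.FluidPDE.LerayHopf
import Literature.Analysis.FluidPDE.SuitableWeak
import HarnessLib

/-!
# Barker–Prange 2021 (JMFM): mild criticality breaking — regularity under a slightly supercritical
# `L^∞_t L^{3−δ}_x` bound, and blow-up of a triple-logarithmic Orlicz functional

Topic `Analysis/FluidPDE`. Source: T. Barker, C. Prange, *Mild criticality breaking for the
Navier–Stokes equations*, J. Math. Fluid Mech. 23 (2021) no. 66, doi:10.1007/s00021-021-00591-1 =
arXiv:2012.09776 [`BarkerPrange2021MildCriticality`]; read in the arXiv version (held text
`paper:arxiv-2012.09776`), §1 (pp. 2–3: the class of (suitable) weak Leray–Hopf solutions,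
**Theorem 1**, **Theorem 2**, the definition of singular points). One file for §1 (D-0064).

## The printed statements (unit viscosity, no force)

* (p. 2) "A weak Leray–Hopf solution `u` is a distributional solution of the Navier–Stokes
  equations, is continuous in time with respect to the weak `L₂` topology and satisfies the energy
  inequality `E(u)(t) := ‖u(·,t)‖²_{L²} + 2∫₀ᵗ∫|∇u|² ≤ ‖u₀‖²_{L²}`." "Suitable weak Leray–Hopf solutions
  … in addition … satisfy the local energy inequality in `ℝ³ × (0,∞)`."
* **Theorem 1.** "For all `M ∈ [1,∞)` and `E ∈ [1,∞)` sufficiently large [footnote: there exists a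
  universal constant `N_univ ∈ [1,∞)` such that for all `M ≥ N_univ` and `E ≥ N_univ` we have the
  result], there exists `δ(M,E) ∈ (0,½]` such that the following holds. Let `u` be a suitable weak
  Leray–Hopf solution to the Navier–Stokes equations on `ℝ³ × (0,∞)` with initial data
  `u₀ ∈ L²(ℝ³) ∩ L⁴(ℝ³)`. Assume that `‖u₀‖_{L²}, ‖u₀‖_{L⁴} ≤ M`, and that
  `‖u‖_{L^∞(0,∞; L^{3−δ(M,E)}(ℝ³))} ≤ E`. Then, the above assumptions imply that `u` is smooth on
  `ℝ³ × (0,∞)`. Moreover, there is an explicit formula for `δ(M,E)` …, and `δ(M,E) → 0` when `E → ∞` or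
  `M → ∞`."
* **Theorem 2.** "There exists a universal constant `θ ∈ (0,1)` such that the following holds. Let `u`
  be a weak Leray–Hopf solution to the Navier–Stokes equations on `ℝ³ × (0,∞)` with initial data
  `u₀ ∈ L²(ℝ³) ∩ L⁴(ℝ³)`. Assume that `u` first blows-up at `T* > 0`, namely
  `u ∈ L^∞_loc(0,T*; L^∞(ℝ³))` and `u ∉ L^∞((½T*, T*); L^∞(ℝ³))`. Then …
  `limsup_{t↑T*} ∫_{ℝ³} |u(x,t)|³ / (log log log((log(e^{e^{3e^e}} + |u(x,t)|))^{1/3}))^θ dx = ∞`."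
  (p. 3: a positive answer to the question raised in Tao 2019, Remark 1.6 — blow-up of the Orlicz
  norm `‖u(t)‖_{L³(log log log L)^{-c}}` — "albeit with an extra logarithm in the denominator".)

## Contents (named facts, D-0014)

* `barkerPrange2021_mild_criticality_breaking` — Theorem 1.
* `barkerPrange2021_orlicz_blowup` — Theorem 2.
* `bpOrliczWeight θ a` — the printed denominator `(log log log((log(e^{e^{3e^e}} + a))^{1/3}))^θ`
  (a real function; `bpOrliczWeight_def`).

## Transcription notes (never stronger than print)

* *Classes.* "Weak Leray–Hopf solution on `ℝ³ × (0,∞)`" = `IsGlobalLerayHopf ν 0 u₀ u` (Leray–Hopf on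
  every `[0,T]`, strict sense — weak solution, energy inequality for every `t` and from a.e. time,
  weak continuity, strong attainment of `u₀`; at least the printed class); "suitable" adds
  `IsSuitableWeakSolutionOn` on the open slab `(0,∞) × ℝ³` for some pressure `p` (the local energy
  inequality of CKN / Seregin's lecture notes, the printed reference). "`u` is smooth on
  `ℝ³ × (0,∞)`" for the a.e.-defined `u` = there is a classical solution `(v,q)` on the open time set
  `(0,∞)` with `u t = v t` a.e. for every `t > 0` — the rendering of `ess_endpoint`.
* *Norm bounds.* `‖u₀‖_{L²}, ‖u₀‖_{L⁴} ≤ M` and `‖u(t)‖_{L^{3−δ}} ≤ E` at every `t > 0` (the `L^∞_t`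
  bound imposed pointwise in `t`: stronger hypothesis) as `eLpNorm` inequalities with the exponent
  `ENNReal.ofReal (3 − δ)`.
* *Thm 2's "first blows-up at `T*`".* `u ∈ L^∞_loc(0,T*; L^∞)` = essential boundedness of
  `uncurry u` on `(ε,T') × ℝ³` for all `0 < ε < T' < T*`; `u ∉ L^∞((½T*,T*); L^∞)` = the essential
  supremum over `(T*/2, T*) × ℝ³` is infinite. `limsup = ∞` is recorded, as for
  `tao_L3_blowup_rate`, as: for every `A`, frequently as `t ↑ T*`, `A < ∫ …` (in `ℝ≥0∞`).
* *Viscosity.* Printed for `ν = 1`; recorded for `ν > 0` through `w(y,s) = ν⁻¹u(y,s/ν)` (a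
  unit-viscosity (suitable) weak Leray–Hopf solution; `‖w₀‖_{L^p} = ν⁻¹‖u₀‖_{L^p}`,
  `‖w(s)‖_{L^{3−δ}} = ν⁻¹‖u(s/ν)‖_{L^{3−δ}}`; smoothness, boundedness and blow-up are unchanged, the
  blow-up time becomes `νT*`). Hence the data/solution bounds read `≤ νM`, `≤ νE`, and Thm 2's
  Orlicz functional is the printed one evaluated at `|w| = |u|/ν`:
  `∫ (|u|/ν)³ / (log log log((log(e^{e^{3e^e}} + |u|/ν))^{1/3}))^θ`. For `ν = 1` both facts are
  literally the printed statements.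
* Not here: the explicit formula of §3 for `δ(M,E)` (`min(3/(4c log K(M,E) − 3), ½)`; it
  involves the constants of Tao's quantitative theorem), Props 3–4 and the proofs (§§2–4).

## Mathlib / tree search

`lean search 'criticality_breaking|orlicz_blowup|2012.09776|logloglog'`: no transcription
(2026-08-26); related tree facts: `tao_quantitative_ess`, `tao_L3_blowup_rate` (Tao 2021),
`ess_endpoint` (rendering of "smooth"), `IsGlobalLerayHopf`, `IsSuitableWeakSolutionOn`, `slab`.
Mathlib has no Navier–Stokes notions.

## References

* T. Barker, C. Prange, J. Math. Fluid Mech. 23 (2021) no. 66 = arXiv:2012.09776: §1 pp. 2–3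
  (Thms 1–2). [`BarkerPrange2021MildCriticality`]
* T. Tao, in *Nine mathematical challenges*, PSPM 104 (2021), Thm. 1.2 and Remark 1.6 (the tree's
  `tao_quantitative_ess`; the Orlicz blow-up question). [`Tao2021`]
-/

noncomputable section

open MeasureTheory Set Function Metric Filter
open _root_.Topology
open scoped ENNReal

namespace Literature.Analysis.FluidPDE

/-- The triple-logarithmic Orlicz weight of Barker–Prange 2021 (JMFM), Theorem 2:
`bpOrliczWeight θ a = (log log log((log(e^{e^{3e^e}} + a))^{1/3}))^θ`; the shift `e^{e^{3e^e}}` makes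
the inner quantities `≥ 1` for `a ≥ 0`. [cite: BarkerPrange2021MildCriticality, Thm. 2 (arXiv:2012.09776 §1 p. 3)] -/
def bpOrliczWeight (θ a : ℝ) : ℝ :=
  Real.log (Real.log (Real.log
    (Real.log (Real.exp (Real.exp (3 * Real.exp (Real.exp 1))) + a) ^ (1 / 3 : ℝ)))) ^ θ

/-- Unfolding `bpOrliczWeight`. [cite: BarkerPrange2021MildCriticality, Thm. 2 (arXiv:2012.09776 §1 p. 3)] -/
theorem bpOrliczWeight_def (θ a : ℝ) :
    bpOrliczWeight θ a = Real.log (Real.log (Real.log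
      (Real.log (Real.exp (Real.exp (3 * Real.exp (Real.exp 1))) + a) ^ (1 / 3 : ℝ)))) ^ θ :=
  rfl

/-- **Barker–Prange 2021 (JMFM), Theorem 1 (mild criticality breaking).** There is a universal
`N ≥ 1` such that for all `M ≥ N` and `E ≥ N` there is `δ = δ(M,E) ∈ (0,½]` with the following
property, for every viscosity `ν > 0`: if `u` is a suitable weak Leray–Hopf solution of the
unforced Navier–Stokes equations with viscosity `ν` on `[0,∞) × ℝ³` (global Leray–Hopf from `u₀`,
suitable weak on the open slab for some pressure `p`) with `‖u₀‖_{L²} ≤ νM`, `‖u₀‖_{L⁴} ≤ νM` and the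
slightly supercritical bound `‖u(t)‖_{L^{3−δ}} ≤ νE` for all `t > 0`, then `u` is smooth on
`(0,∞) × ℝ³`: some classical solution `(v,q)` on the time set `(0,∞)` has `u t = v t` a.e. for every
`t > 0`. Printed for `ν = 1` (bounds `≤ M`, `≤ E`); general `ν` by `w(y,s) = ν⁻¹u(y,s/ν)` (module
docstring). [cite: BarkerPrange2021MildCriticality, Thm. 1 (arXiv:2012.09776 §1 p. 2)] -/
def barkerPrange2021_mild_criticality_breaking : Prop :=
  ∃ N : ℝ, 1 ≤ N ∧ ∀ M : ℝ, N ≤ M → ∀ E : ℝ, N ≤ E → ∃ δ : ℝ, 0 < δ ∧ δ ≤ 1 / 2 ∧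
    ∀ ν : ℝ, 0 < ν →
      ∀ (u₀ : EuclideanSpace ℝ (Fin 3) → EuclideanSpace ℝ (Fin 3))
        (u : ℝ → EuclideanSpace ℝ (Fin 3) → EuclideanSpace ℝ (Fin 3))
        (p : ℝ → EuclideanSpace ℝ (Fin 3) → ℝ),
        IsGlobalLerayHopf ν 0 u₀ u →
        IsSuitableWeakSolutionOn (slab (EuclideanSpace ℝ (Fin 3)) (Ioi 0) isOpen_Ioi) ν 0 u p →
        eLpNorm u₀ 2 volume ≤ ENNReal.ofReal (ν * M) →
        eLpNorm u₀ 4 volume ≤ ENNReal.ofReal (ν * M) →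
        (∀ t ∈ Ioi (0 : ℝ),
          eLpNorm (u t) (ENNReal.ofReal (3 - δ)) volume ≤ ENNReal.ofReal (ν * E)) →
        ∃ (v : ℝ → EuclideanSpace ℝ (Fin 3) → EuclideanSpace ℝ (Fin 3))
          (q : ℝ → EuclideanSpace ℝ (Fin 3) → ℝ),
          IsClassicalNSSolutionOn (Ioi 0) ν 0 v q ∧ ∀ t ∈ Ioi (0 : ℝ), u t =ᵐ[volume] v t

/-- **Barker–Prange 2021 (JMFM), Theorem 2 (blow-up of a triple-logarithmic Orlicz functional; the
question of Tao 2021, Remark 1.6, up to one extra logarithm).** There is a universal `θ ∈ (0,1)` such that for every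
viscosity `ν > 0` and every `T > 0`: if `u` is a global Leray–Hopf weak solution of the unforced
Navier–Stokes equations with viscosity `ν` from a datum `u₀ ∈ L² ∩ L⁴` which **first blows up at
`T`** — essentially bounded on `(ε,T') × ℝ³` for all `0 < ε < T' < T`, and NOT essentially bounded on
`(T/2, T) × ℝ³` — then
`limsup_{t↑T} ∫ (|u(x,t)|/ν)³ / (log log log((log(e^{e^{3e^e}} + |u(x,t)|/ν))^{1/3}))^θ dx = ∞`
(recorded: for every `A`, frequently as `t ↑ T`, the integral exceeds `A`). Printed for `ν = 1`, where
the functional is `∫ |u|³ / (log log log((log(e^{e^{3e^e}} + |u|))^{1/3}))^θ`; general `ν` by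
`w = ν⁻¹u(·, ·/ν)` (module docstring). [cite: BarkerPrange2021MildCriticality, Thm. 2 (arXiv:2012.09776 §1 p. 3)] -/
def barkerPrange2021_orlicz_blowup : Prop :=
  ∃ θ : ℝ, 0 < θ ∧ θ < 1 ∧ ∀ (ν T : ℝ), 0 < ν → 0 < T →
    ∀ (u₀ : EuclideanSpace ℝ (Fin 3) → EuclideanSpace ℝ (Fin 3))
      (u : ℝ → EuclideanSpace ℝ (Fin 3) → EuclideanSpace ℝ (Fin 3)),
      IsGlobalLerayHopf ν 0 u₀ u → MemLp u₀ 2 volume → MemLp u₀ 4 volume →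
      (∀ ε T' : ℝ, 0 < ε → ε < T' → T' < T →
        eLpNorm (uncurry u) ∞ (volume.restrict (Ioo ε T' ×ˢ univ)) < ∞) →
      eLpNorm (uncurry u) ∞ (volume.restrict (Ioo (T / 2) T ×ˢ univ)) = ∞ →
      ∀ A : ℝ, ∃ᶠ t in 𝓝[<] T,
        ENNReal.ofReal A <
          ∫⁻ x, ENNReal.ofReal ((‖u t x‖ / ν) ^ 3 / bpOrliczWeight θ (‖u t x‖ / ν))

end Literature.Analysis.FluidPDE

end
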